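import Summits.QuantumFields.YangMills.Theorems.BalabanUVNodesN08AlphaAdaptedEnd

/-!
# Route «BalabanUVNodes», Track-A DAG node N08 = [Balaban1985UV3] — THE (α) CLAUSE: the one in-edge hypothesis (b11″) FROM REGULAR `h`-LARGE
# PROFILES — the in-edge side of the (α) clause as «every admissible history is exhibited by a configuration of the adapted regular class»

Cell `pub-ymgap`, seat `pub-ymgap-dag-n08-d` gen 4, file 12 (director-ym R134 row «CLASS-I in-edge conclusions at the (α) granularity of `RunAlpha`»).
`bears_on: R4∕N08`; filed `--supports stmt-QuantumFields-19903 --as helper`.  Sorry-free, standard axioms.  Corollary file over 10∕11.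

THE POINT.  In (b11″) (`…AdaptedSel.exists_externalInputs_faces₃_adapted`) the `h`-large data `Vl k h` and the top clause (`Sm`, `T`, `Bk`) are the
consumer's.  Choosing the data to BE the lifted averages of a given configuration `W k h` («the profile of the history») and dropping the top clause
(`Sm := ∅` — legitimate: the three faces never read «V_k = V»), the constraint space contains `W k h` itself as soon as `W k h` lies in the adapted
closed class: (b11″) holds with NO constraint-solving.  So the in-edge side of the (α) clause is the sentence
(b11‴) «for every step `k ≤ K` and admissible history `h` there is a configuration of [7]'s closed regular class over the `Ω_j(h)` whose iterated
`log`-arguments stay `≤ ¼` and whose lifted `j`-fold averages are `h`-LARGE on `Λ_j(h)`» — a pure EXISTENCE-OF-PROFILE statement (realisability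
of the history inside the regular class; automatic at the trivial history).
* `mem_admB42a_profile`, `hne_of_profile` — (b11″) from a profile; ★ `exists_externalInputs_faces₃_of_profile`, ★ `exists_externalInputs_runAlpha_of_profile`
  (the (α) clause from the DATA schema + (b11‴), objective = a Wilson action).
HONEST FRAMING: (b11‴) DISPLAYED; the selected `U_k(·, h)` is then `V`-independent (a minimiser of the Wilson action on the profile's constraint space —
NOT print's `U_k(V)`, whose `V`-dependence enters the lane only through the DATA rows); nothing of [B10] ∕ [7] ∕ [4] asserted; count-neutral; NOT a
discharge of N08.  d = 3 lattice gauge theory on finite tori as printed; nothing about d = 4, the continuum, OS axioms, a mass gap or the Clay problem.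
-/

noncomputable section

namespace Summit.QuantumFields.YangMills.Theorems.BalabanUVNodesN08AlphaProfile

open MeasureTheory Set Topology TopologicalSpace
open scoped Matrix Matrix.Norms.L2Operator
open Literature.MathematicalPhysics.QuantumFieldTheory.Balaban1983to89
open Literature.MathematicalPhysics.QuantumFieldTheory.Balaban1983to89.B10 (pFun)
open Literature.MathematicalPhysics.QuantumFieldTheory.Balaban1983to89.B10SectCExpansion (TermSizes)
open Literature.MathematicalPhysics.QuantumFieldTheory.Balaban1985CMP102
open Literature.MathematicalPhysics.QuantumFieldTheory.Balaban1985CMP102.Setting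
open Summit.QuantumFields.Balaban3D.Carriers
open Summit.QuantumFields.Balaban3D.Proofs.Inputs
open Summit.QuantumFields.Balaban3D.Proofs.Primitives (AlphaConsts)
open Summit.QuantumFields.Balaban3D.Proofs.GroupModelLieC (lieC)
open Summit.QuantumFields.Balaban3D.Proofs.UVStability3DInputs
open Summit.QuantumFields.Balaban3D.Proofs.LiftBridge (liftCfg)
open Summit.QuantumFields.Balaban3D.Proofs.TorusLift (projSite)
open Summit.QuantumFields.YangMills.Theorems.BalabanUVNodesN08AlphaClassI
open Summit.QuantumFields.YangMills.Theorems.BalabanUVNodesN08AlphaLoop28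
open Summit.QuantumFields.YangMills.Theorems.BalabanUVNodesN08AlphaThreeFaces (regMin gammaN08)
open Summit.QuantumFields.YangMills.Theorems.BalabanUVNodesN08AlphaGroupTopology
open Summit.QuantumFields.YangMills.Theorems.BalabanUVNodesN08AlphaRegSel
open Summit.QuantumFields.YangMills.Theorems.BalabanUVNodesN08AlphaInB42Sel
open Summit.QuantumFields.YangMills.Theorems.BalabanUVNodesN08AlphaCompactSel
open Summit.QuantumFields.YangMills.Theorems.BalabanUVNodesN08AlphaArgClass
open Summit.QuantumFields.YangMills.Theorems.BalabanUVNodesN08AlphaAdaptedSel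
open Summit.QuantumFields.YangMills.Theorems.BalabanUVNodesN08AlphaAdaptedEnd
open B7Prop2Explicit (avgIter)

variable {L : ℕ} {S : Scales L} {G : Type} [GaugeGroup G] [MeasurableSpace G]

/-! ## §1 (b11″) from a profile -/

section Profile

variable (𝔊 : GroupModel G) (𝔠 : AlphaConsts L 𝔊.N)

/-- **A CONFIGURATION OF THE ADAPTED CLOSED CLASS LIES IN THE CONSTRAINT SPACE OF ITS OWN PROFILE** (data := its lifted averages, no top clause at `V`).
[cite: Balaban1985UV3, (42) p.266; Balaban1985Variational, (3)+(8) pp.278–279] -/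
theorem mem_admB42a_profile {k : ℕ} (hk : k ≤ S.K) (h : Hist S.P k) {W : GaugeField S.P 0 G}
    (hW : W ∈ regClassC 𝔊 𝔠 k h ∩ argClassC 𝔊 k) (Sm : Set (GaugeField S.P k G)) (T : GaugeField S.P 0 G → GaugeField S.P k G)
    (Bk : Set (PBond S.P k)) {V : GaugeField S.P k G} (hV : V ∉ Sm) :
    W ∈ admB42a 𝔊 𝔠 k h (fun j => avgIter L (liftCfg 𝔊 W) j) Sm T Bk V := by
  rw [admB42a_of_le 𝔊 𝔠 hk]
  exact ⟨⟨⟨regClassC_subset_regClass 𝔊 𝔠 hk h hW.1, fun _ _ _ _ _ _ => rfl, fun hs => absurd hs hV⟩, hW.1⟩, hW.2⟩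

/-- **(b11″) FROM PROFILES**: if every admissible history of the run is exhibited by SOME configuration of the adapted closed class (regardless of
largeness, which is the face's concern — see `exists_externalInputs_faces₃_of_profile`), the constraint spaces of the profiles are non-empty for every
`V` (no top clause). [cite: Balaban1985Variational, Thm 1 (8) p.279 (kinematic reading)] -/
theorem hne_of_profile (W : (k : ℕ) → Hist S.P k → GaugeField S.P 0 G)
    (hW : ∀ k, k ≤ S.K → ∀ (h : Hist S.P k), Hist.Admissible 𝔠.lane.carrier.M₁ (rcolOf S 𝔠.lane.carrier) k h →
      W k h ∈ regClassC 𝔊 𝔠 k h ∩ argClassC 𝔊 k)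
    (T : (k : ℕ) → GaugeField S.P 0 G → GaugeField S.P k G) (Bk : (k : ℕ) → Hist S.P k → Set (PBond S.P k)) :
    ∀ k, k ≤ S.K → ∀ (h : Hist S.P k), Hist.Admissible 𝔠.lane.carrier.M₁ (rcolOf S 𝔠.lane.carrier) k h →
      ∀ (V : GaugeField S.P k G), (admB42a 𝔊 𝔠 k h (fun j => avgIter L (liftCfg 𝔊 (W k h)) j) (∅ : Set (GaugeField S.P k G)) (T k) (Bk k h) V).Nonempty :=
  fun k hk h hh V => ⟨W k h, mem_admB42a_profile 𝔊 𝔠 hk h (hW k hk h hh) ∅ (T k) (Bk k h) (Set.notMem_empty V)⟩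

end Profile

/-! ## §2 The faces and the (α) clause from regular `h`-large profiles -/

section End

variable [HaarData G] (𝔊 : GroupModel G) (𝔠 : AlphaConsts L 𝔊.N)

/-- **★ `InEdgeFaces₃` FROM REGULAR `h`-LARGE PROFILES (b11‴).**  If for every step `k ≤ K` and admissible history `h` there is a configuration `W k h`
of [7]'s closed regular class over the `Ω_j(h)` (half constant) with iterated `log`-arguments `≤ ¼` whose lifted `j`-fold averages are `h`-LARGE on
`Λ_j(h)`, then there are external inputs (same `av`, `reg` as `X₀`; `U_k(·, h)` = measurable minimisers of `A` on the profiles' constraint spaces) with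
`InEdgeFaces₃ 𝔊 𝔠 X`. [cite: Balaban1985UV3, (42) p.266 + (67)–(68) p.273; Balaban1985Variational, (2)+(3)+(8) pp.278–279] -/
theorem exists_externalInputs_faces₃_of_profile (X₀ : ExternalInputs S G) {A : GaugeField S.P 0 G → ℝ}
    (hA : letI := rhoTopology 𝔊; Continuous A) (W : (k : ℕ) → Hist S.P k → GaugeField S.P 0 G)
    (hW : ∀ k, k ≤ S.K → ∀ (h : Hist S.P k), Hist.Admissible 𝔠.lane.carrier.M₁ (rcolOf S 𝔠.lane.carrier) k h →
      W k h ∈ regClassC 𝔊 𝔠 k h ∩ argClassC 𝔊 k)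
    (hWL : ∀ (k : ℕ) (h : Hist S.P k), HLarge S 𝔠.lane.carrier.b₀ 𝔠.lane.carrier.p₀ h (fun j => avgIter L (liftCfg 𝔊 (W k h)) j))
    (T : (k : ℕ) → GaugeField S.P 0 G → GaugeField S.P k G) (Bk : (k : ℕ) → Hist S.P k → Set (PBond S.P k))
    (hT : letI := rhoTopology 𝔊; ∀ (k : ℕ) (h : Hist S.P k), ContinuousOn (T k) (regClass 𝔊 𝔠 k h)) :
    ∃ X : ExternalInputs S G, X.av = X₀.av ∧ X.reg = X₀.reg ∧ (∀ (k : ℕ) (h : Hist S.P k), Measurable (X.UkH k h)) ∧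
      InEdgeFaces₃ 𝔊 𝔠 X := by
  letI := rhoTopology 𝔊
  obtain ⟨X, hav, hreg, hm, -, -, -, F⟩ := exists_externalInputs_faces₃_adapted 𝔊 𝔠 X₀ hA
    (fun k h j => avgIter L (liftCfg 𝔊 (W k h)) j) hWL (fun _ _ => ∅) (fun _ _ => isOpen_empty) T Bk hT (hne_of_profile 𝔊 𝔠 W hW T Bk)
  exact ⟨X, hav, hreg, hm, F⟩

/-- **★ THE (α) CLAUSE FROM THE DATA SCHEMA AND REGULAR `h`-LARGE PROFILES (b11‴)** — standard external inputs, objective = a Wilson action, top map =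
the iterated standard averaging (continuous; unread since the top clause is dropped): external inputs EXIST (`InEdgeFaces₃ 𝔊 (regMin 𝔠) X`, measurable
`U_k(·, h)`) such that for every `𝔖, 𝔄, coef` the DATA schema on the N08 family gives `RunAlpha 𝔊 𝔠 X 𝔖 𝔄`.
[cite: Balaban1985UV3, (41)–(42) p.266 + (67)–(68) p.273; Balaban1985Variational, Thm 1 (8) p.279 (kinematic reading)] -/
theorem exists_externalInputs_runAlpha_of_profile (X₀ : ExternalInputs S G) (hstd : X₀.av = AveragingRT.stdAvg S.P G) (w : ℝ)
    (W : (k : ℕ) → Hist S.P k → GaugeField S.P 0 G)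
    (hW : ∀ k, k ≤ S.K → ∀ (h : Hist S.P k), Hist.Admissible (regMin 𝔠).lane.carrier.M₁ (rcolOf S (regMin 𝔠).lane.carrier) k h →
      W k h ∈ regClassC 𝔊 (regMin 𝔠) k h ∩ argClassC 𝔊 k)
    (hWL : ∀ (k : ℕ) (h : Hist S.P k),
      HLarge S (regMin 𝔠).lane.carrier.b₀ (regMin 𝔠).lane.carrier.p₀ h (fun j => avgIter L (liftCfg 𝔊 (W k h)) j))
    (Bk : (k : ℕ) → Hist S.P k → Set (PBond S.P k)) :
    ∃ X : ExternalInputs S G, X.av = AveragingRT.stdAvg S.P G ∧ X.reg = X₀.reg ∧ (∀ (k : ℕ) (h : Hist S.P k), Measurable (X.UkH k h)) ∧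
      InEdgeFaces₃ 𝔊 (regMin 𝔠) X ∧
      ∀ (𝔖 : ∀ k, StepSeries S G ↥(lieC 𝔊) (nblkOf S 𝔠.lane.carrier k) k) (𝔄 : AlphaData 𝔊 𝔠 X 𝔖)
        (coef : (k : ℕ) → Hist S.P (k + 1) → GaugeField S.P (k + 1) G → (j : ℕ) → TermSizes (oldGeom S.P k j)),
        S.g ^ 2 * S.ε₀ ≤ (min (gammaN08 𝔠) 1) ^ 2 → RunDataRows 𝔊 𝔠 X 𝔖 𝔄 (sizesOf 𝔊 𝔠 X coef) → RunAlpha 𝔊 𝔠 X 𝔖 𝔄 := by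
  letI := rhoTopology 𝔊
  exact exists_externalInputs_runAlpha_adapted_std 𝔊 𝔠 X₀ hstd w (fun k h j => avgIter L (liftCfg 𝔊 (W k h)) j) hWL (fun _ _ => ∅)
    (fun _ _ => isOpen_empty) Bk (hne_of_profile 𝔊 (regMin 𝔠) W hW (fun k => Averaging.iter X₀.av k) Bk)

end End

end Summit.QuantumFields.YangMills.Theorems.BalabanUVNodesN08AlphaProfile

end
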